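import Literature.Topology.PlanarFoliations.BiOrient
import Literature.Topology.PlanarFoliations.Renorm
import HarnessLib

/-!
# Restricting a planar foliation to an open subset

Topic: Topology / PlanarFoliations. For a foliation `F : Foliation ℝ X` with one-dimensional
leaves and an open subset `U` of `X`, the **restriction** `restrictOpen F U : Foliation ℝ U`:
its atlas consists of the renormalisations (`Renorm.lean`: small boxes blown up onto the whole
plane by increasing homeomorphisms of both coordinates) of the flow boxes of `F` whose sources
lie in `U`, restricted to the subtype `U`. Since the renormalisations preserve equality and
order of heights and of leaf coordinates, the restriction inherits the plaque compatibility,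
the transverse orientation and the bi-orientation of `F`, and its plaques are pieces of
plaques of `F` (so its leaves lie in leaves of `F`).

* `restrictOpen F U` (**definition**), `mem_restrictOpen_atlas_iff`;
* `isTransverselyOriented_restrictOpen`, `isBiOriented_restrictOpen` (**proved**);
* `samePlaque_of_restrictOpen`, `leaf_restrictOpen_subset` (**proved**): leaves of the
  restriction lie in leaves of `F`.

Use: removing a point of a compact leaf makes the rest of the leaf an open leaf of the
restriction, to which the Poincaré–Bendixson theory of open leaves applies. All statements are
[folklore].
-/

noncomputable section

open Set Filter Function TopologicalSpace
open _root_.Topology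
open Literature.Topology.FourManifolds Literature.Topology.FourManifolds.Foliation

namespace Literature.Topology.PlanarFoliations

variable {X : Type*} [TopologicalSpace X] (F : Foliation ℝ X) (U : Opens X) [hU : Nonempty U]

/-- A **restricted box**: the renormalisation of a box of an atlas chart whose source lies in `U`,
restricted to the subtype `U`. [folklore] -/
def IsRestrictedBox (c : OpenPartialHomeomorph U (ℝ × ℝ)) : Prop :=
  ∃ (e : OpenPartialHomeomorph X (ℝ × ℝ)) (_ : e ∈ F.atlas) (p : ℝ × ℝ) (r : ℝ) (hr : 0 < r),
    (renormBox e p r hr).source ⊆ (U : Set X) ∧ c = (renormBox e p r hr).subtypeRestr hU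

variable {F U}

/-- The target of a restricted box is the whole plane. [folklore] -/
theorem target_eq_of_isRestrictedBox {c : OpenPartialHomeomorph U (ℝ × ℝ)} (hc : IsRestrictedBox F U c) : c.target = univ := by
  obtain ⟨e, he, p, r, hr, hsub, rfl⟩ := hc
  have htgt : (renormBox e p r hr).target = univ := renormBox_target (by rw [F.target_eq e he]; exact subset_univ _)
  apply Subset.antisymm (subset_univ _)
  intro w _
  -- `w = renormBox (renormBox.symm w)` with `renormBox.symm w ∈ source ⊆ U`
  have hw : w ∈ (renormBox e p r hr).target := by rw [htgt]; exact mem_univ _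
  have hsrc := (renormBox e p r hr).map_target hw
  have key := (renormBox e p r hr).map_subtype_source hU (x := ⟨(renormBox e p r hr).symm w, hsub hsrc⟩) hsrc
  rwa [show (renormBox e p r hr) (⟨(renormBox e p r hr).symm w, hsub hsrc⟩ : U) = w from
    (renormBox e p r hr).right_inv hw] at key

/-- **The restriction of `F` to the open subset `U`.** [folklore] -/
def restrictOpen (F : Foliation ℝ X) (U : Opens X) [hU : Nonempty U] : Foliation ℝ U where
  atlas := {c | IsRestrictedBox F U c}
  target_eq c hc := target_eq_of_isRestrictedBox hc
  exists_mem_source y := by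
    obtain ⟨e, he, hye⟩ := F.exists_mem_source (y : X)
    obtain ⟨r, hr, hsub⟩ := exists_renormBox_source_subset hye (U.2.mem_nhds y.2)
    refine ⟨(renormBox e (e y) r hr).subtypeRestr hU, ⟨e, he, e y, r, hr, hsub hr, rfl⟩, ?_⟩
    rw [OpenPartialHomeomorph.subtypeRestr_source, mem_preimage]
    exact mem_renormBox_source_self hye hr
  locally_plaque c hc c' hc' y hy := by
    obtain ⟨e, he, p, r, hr, hsub, rfl⟩ := hc
    obtain ⟨e', he', p', r', hr', hsub', rfl⟩ := hc'
    rw [OpenPartialHomeomorph.subtypeRestr_source, OpenPartialHomeomorph.subtypeRestr_source] at hy ⊢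
    obtain ⟨hy₁, hy₂⟩ := hy
    have hye : (y : X) ∈ e.source := renormBox_source_subset e p r hr hy₁
    have hye' : (y : X) ∈ e'.source := renormBox_source_subset e' p' r' hr' hy₂
    obtain ⟨V, hV, hVplaque⟩ := F.locally_plaque e he e' he' y ⟨hye, hye'⟩
    refine ⟨Subtype.val ⁻¹' V, continuous_subtype_val.continuousAt.preimage_mem_nhds hV, ?_⟩
    rintro w ⟨hwV, hw₁, hw₂⟩ z ⟨hzV, hz₁, hz₂⟩ hEq
    rw [mem_preimage] at hw₁ hw₂ hz₁ hz₂
    simp only [OpenPartialHomeomorph.subtypeRestr_coe, restrict_apply] at hEq ⊢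
    rw [renormBox_snd_eq_iff hw₂ hz₂]
    rw [renormBox_snd_eq_iff hw₁ hz₁] at hEq
    exact hVplaque w ⟨hwV, renormBox_source_subset e p r hr hw₁, renormBox_source_subset e' p' r' hr' hw₂⟩
      z ⟨hzV, renormBox_source_subset e p r hr hz₁, renormBox_source_subset e' p' r' hr' hz₂⟩ hEq

/-- Membership in the atlas of the restriction. [folklore] -/
theorem mem_restrictOpen_atlas_iff {c : OpenPartialHomeomorph U (ℝ × ℝ)} :
    c ∈ (restrictOpen F U).atlas ↔ IsRestrictedBox F U c := Iff.rfl

/-- **Restricted boxes of a given chart**: for `e ∈ F.atlas` and a box of `e` inside `U`, the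
restricted renormalised box is a chart of the restriction. [folklore] -/
theorem subtypeRestr_renormBox_mem {e : OpenPartialHomeomorph X (ℝ × ℝ)} (he : e ∈ F.atlas) {p : ℝ × ℝ} {r : ℝ}
    (hr : 0 < r) (hsub : (renormBox e p r hr).source ⊆ (U : Set X)) :
    (renormBox e p r hr).subtypeRestr hU ∈ (restrictOpen F U).atlas :=
  ⟨e, he, p, r, hr, hsub, rfl⟩

/-- **The restriction is transversely oriented if `F` is.** [folklore] -/
theorem isTransverselyOriented_restrictOpen (ho : F.IsTransverselyOriented) : (restrictOpen F U).IsTransverselyOriented := by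
  rintro c ⟨e, he, p, r, hr, hsub, rfl⟩ c' ⟨e', he', p', r', hr', hsub', rfl⟩ y hy
  rw [OpenPartialHomeomorph.subtypeRestr_source, OpenPartialHomeomorph.subtypeRestr_source] at hy
  obtain ⟨hy₁, hy₂⟩ := hy
  have hye : (y : X) ∈ e.source := renormBox_source_subset e p r hr hy₁
  have hye' : (y : X) ∈ e'.source := renormBox_source_subset e' p' r' hr' hy₂
  obtain ⟨V, hV, hVo⟩ := ho e he e' he' y ⟨hye, hye'⟩
  refine ⟨Subtype.val ⁻¹' V, continuous_subtype_val.continuousAt.preimage_mem_nhds hV, ?_⟩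
  rintro w ⟨hwV, hw₁, hw₂⟩ z ⟨hzV, hz₁, hz₂⟩ hlt
  rw [OpenPartialHomeomorph.subtypeRestr_source, mem_preimage] at hw₁ hw₂ hz₁ hz₂
  simp only [OpenPartialHomeomorph.subtypeRestr_coe, restrict_apply] at hlt ⊢
  rw [renormBox_snd_lt_iff hw₂ hz₂]
  rw [renormBox_snd_lt_iff hw₁ hz₁] at hlt
  exact hVo w ⟨hwV, renormBox_source_subset e p r hr hw₁, renormBox_source_subset e' p' r' hr' hw₂⟩
    z ⟨hzV, renormBox_source_subset e p r hr hz₁, renormBox_source_subset e' p' r' hr' hz₂⟩ hlt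

/-- **The restriction is bi-oriented if `F` is.** [folklore] -/
theorem isBiOriented_restrictOpen (hbi : IsBiOriented F) : IsBiOriented (restrictOpen F U) := by
  rintro c ⟨e, he, p, r, hr, hsub, rfl⟩ c' ⟨e', he', p', r', hr', hsub', rfl⟩ y hy
  rw [OpenPartialHomeomorph.subtypeRestr_source, OpenPartialHomeomorph.subtypeRestr_source] at hy
  obtain ⟨hy₁, hy₂⟩ := hy
  have hye : (y : X) ∈ e.source := renormBox_source_subset e p r hr hy₁
  have hye' : (y : X) ∈ e'.source := renormBox_source_subset e' p' r' hr' hy₂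
  obtain ⟨V, hV, hVo⟩ := hbi e he e' he' y ⟨hye, hye'⟩
  refine ⟨Subtype.val ⁻¹' V, continuous_subtype_val.continuousAt.preimage_mem_nhds hV, ?_⟩
  rintro w ⟨hwV, hw₁, hw₂⟩ z ⟨hzV, hz₁, hz₂⟩ hEq hlt
  rw [OpenPartialHomeomorph.subtypeRestr_source, mem_preimage] at hw₁ hw₂ hz₁ hz₂
  simp only [OpenPartialHomeomorph.subtypeRestr_coe, restrict_apply] at hEq hlt ⊢
  rw [renormBox_fst_lt_iff hw₂ hz₂]
  rw [renormBox_snd_eq_iff hw₁ hz₁] at hEq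
  rw [renormBox_fst_lt_iff hw₁ hz₁] at hlt
  exact hVo w ⟨hwV, renormBox_source_subset e p r hr hw₁, renormBox_source_subset e' p' r' hr' hw₂⟩
    z ⟨hzV, renormBox_source_subset e p r hr hz₁, renormBox_source_subset e' p' r' hr' hz₂⟩ hEq hlt

/-- **Plaques of the restriction are pieces of plaques of `F`.** [folklore] -/
theorem samePlaque_of_restrictOpen {y z : U} (h : (restrictOpen F U).SamePlaque y z) : F.SamePlaque (y : X) (z : X) := by
  obtain ⟨c, ⟨e, he, p, r, hr, hsub, rfl⟩, hy, hz, hEq⟩ := h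
  rw [OpenPartialHomeomorph.subtypeRestr_source, mem_preimage] at hy hz
  simp only [OpenPartialHomeomorph.subtypeRestr_coe, restrict_apply] at hEq
  rw [renormBox_snd_eq_iff hy hz] at hEq
  exact ⟨e, he, renormBox_source_subset e p r hr hy, renormBox_source_subset e p r hr hz, hEq⟩

/-- **Leaves of the restriction lie in leaves of `F`.** [folklore] -/
theorem leaf_restrictOpen_subset (y : U) : (restrictOpen F U).leaf y ⊆ Subtype.val ⁻¹' F.leaf (y : X) := by
  intro z hz
  rw [mem_preimage, Foliation.mem_leaf_iff]
  induction hz with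
  | rel a b hab => exact Relation.EqvGen.rel _ _ (samePlaque_of_restrictOpen hab)
  | refl => exact Relation.EqvGen.refl _
  | symm a b _ ih => exact Relation.EqvGen.symm _ _ ih
  | trans a b c _ _ ih₁ ih₂ => exact Relation.EqvGen.trans _ _ _ ih₁ ih₂

/-- **Conversely, a plaque piece of `F` inside `U` around a point is a plaque of the
restriction**: if `y, z ∈ U` lie on a plaque of `e ∈ F.atlas` and in a common box of `e` inside
`U`, they lie on a plaque of the restriction. [folklore] -/
theorem samePlaque_restrictOpen_of_mem_box {e : OpenPartialHomeomorph X (ℝ × ℝ)} (he : e ∈ F.atlas) {p : ℝ × ℝ} {r : ℝ}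
    (hr : 0 < r) (hsub : (renormBox e p r hr).source ⊆ (U : Set X)) {y z : U}
    (hy : (y : X) ∈ (renormBox e p r hr).source) (hz : (z : X) ∈ (renormBox e p r hr).source)
    (hEq : (e y).2 = (e z).2) : (restrictOpen F U).SamePlaque y z := by
  refine ⟨(renormBox e p r hr).subtypeRestr hU, subtypeRestr_renormBox_mem he hr hsub, ?_, ?_, ?_⟩
  · rw [OpenPartialHomeomorph.subtypeRestr_source, mem_preimage]; exact hy
  · rw [OpenPartialHomeomorph.subtypeRestr_source, mem_preimage]; exact hz
  · simp only [OpenPartialHomeomorph.subtypeRestr_coe, restrict_apply]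
    exact (renormBox_snd_eq_iff hy hz).2 hEq

end Literature.Topology.PlanarFoliations
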